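import Literature.RepresentationTheory.Kovacevic2021.SU21VertexRigidity
import Literature.RepresentationTheory.Kovacevic2021.SU21CasimirIrreducible
import Literature.RepresentationTheory.Kovacevic2021.SU21SubmoduleLattice
import HarnessLib

/-!
# Classification of the cohomological `K`-type data for `SU(2,1)` (Borel–Wallach VI Thm 4.11 (1),
# datum form): an irreducible datum with `H^q(𝔤,𝔨;V) ≠ 0` has the `K`-types of one of the six modules

Continuation of `Literature.RepresentationTheory.Kovacevic2021.SU21VertexRigidity` (cone lemma, vertex
equation, unique continuation from the vertex), `SU21CasimirIrreducible` (an irreducible datum with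
`dim H^q(𝔤𝔩₃,𝔨;V) ≠ 0` has Casimir scalar `0` on all its `K`-types and contains one of the six `K`-types
`V_{1,0}, V_{2,±3}, V_{1,±6}, V_{3,0}` of `Λ^•𝔭`) and `SU21SubmoduleLattice` (irreducibility ⇔ every
arrow-closed set of `K`-types meeting `S` contains `S`).

**Statement proved** (`exists_model_of_isIrreducible`, `S_eq_six_of_isIrreducible`).  Let `𝒟` be
Kovačević `K`-type data [Kovacevic2021, §3 Thm 1, Thm 2] whose `𝔤𝔩(3,ℂ)`-module `𝒟.V` is irreducible and
has `dim H^q(𝔤𝔩₃, 𝔨; V) ≠ 0` for some `q`.  Then the set of `K`-types `𝒟.S` is the `K`-type set of exactly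
one of `U(0) = J_{0,0}` (`trivialMod`), `U(0,6) = D₂` (`holDS`), `U(0,-6) = D₀` (`antiholDS`),
`Z(3) = J_{1,0}` (`ladderPlus`), `Z(-3) = J_{0,1}` (`ladderMinus`), `W(3,0) = D₁` (`midDS`), and the
gauge-invariant products `A_{n,m}D_{n+1,m+3}`, `B_{n,m}C_{n+1,m-3}` [Kovacevic2021, Remark 3] of `𝒟` are
those of that model.  This is [BorelWallach2000, VI Thm 4.11 (1)] ("`H^*(𝔤,K;V) ≠ 0 ⇒ V ∈ Π^ρ(G)`",
`Π^ρ(SU(2,1)) = {J_{00}, J_{10}, J_{01}, D₀, D₁, D₂}` by VI 4.8) at the level of `K`-type data; the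
purely combinatorial core (`exists_model_of_forall_reach`) needs only strong connectivity of the live
arrows, `Ω`-scalar `0` on `S`, and an `F`-label in `S`.

**Proof** (ours; the sources argue via infinitesimal characters and Vogan–Zuckerman, which the tree does
not have).  Take a `K`-type `x₀` of least dimension; it is a local minimum, so by the cone lemma `S` lies in
the cone above `x₀`, `x₀` is the unique local minimum, and every other `K`-type has a lower neighbour
joined by a live edge.  The vertex equation gives `x₀ ∈ {(2,±3), (3,0)}` or `n₀ = 1`; in the latter case
the `F`-label lies in the cone above `x₀ = (1, m₀)` and in the lattice `(1+p+q, 3p-3q)`, forcing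
`m₀ ∈ {0, ±6}`.  Each of the six possible vertices is the vertex of one of the six models, which is
generated downward from it and has `Ω = 0`; unique continuation from the vertex identifies `S` and the
products.

## What is here (theorems only; no definitions, no named facts)

* §1 the six models are generated downward from their vertices (`trivialMod_lower`, `holDS_lower`, …);
* §2 `vertex_mem_six` (the vertex of a strongly connected cohomological datum);
* §3 `exists_model_of_forall_reach`, `S_eq_six_of_forall_reach` (combinatorial classification);
* §4 `forall_reach_of_isIrreducible` (irreducible ⇒ strongly connected, from `isIrreducible_iff_closed`),
  `exists_model_of_isIrreducible`, `S_eq_six_of_isIrreducible` (BW VI 4.11 (1), datum form).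

## References

* A. Borel, N. Wallach (2000), VI 4.8 p. 131, Thm 4.11 (1) p. 132 (held chunks p0165–p0169 of
  `book:borel2000-…`). [BorelWallach2000]
* D. Kovačević, *Unitary `(𝔤,K)` modules of `SU(2,1)`*, Acta Math. Spalatensia 1 (2021) 105–125
  (arXiv:1810.01752): §3 Thm 2, Remark 3, Thm 3, §4 Thm 5. [Kovacevic2021]
-/

noncomputable section

open Module
open Literature.Algebra.Lie Literature.Algebra.Lie.ChevalleyEilenberg

namespace Literature.RepresentationTheory.Kovacevic2021

-- Mathlib idiom (Mathlib/Algebra/Lie/OfAssociative.lean): commutator brackets on associative algebras; needed for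
-- `LieModule.IsIrreducible ℂ gl3 𝒟.V` in §4, as in every file of this directory that mentions the `𝔤𝔩(3,ℂ)`-action.
attribute [local instance 100] LieRing.ofAssociativeRing

namespace SU21Datum

/-! ## §1 The six models are generated downward from their vertices -/

section Models

/-- On a north-east ray datum every `K`-type above the bottom one is reached from the `K`-type below it
by a live `A`–`D` edge: `A_{n-1,m-3} D_{n,m} = -(2n+e-1)/2 ≠ 0`. [cite: Kovacevic2021, §3 Thm 3 (b75), §4] -/
private theorem rayNE_lower (e n₀ : ℤ) (h₀ : 1 ≤ n₀) (h : 2 * n₀ ^ 2 + (e - 3) * n₀ + (1 - e) = 0)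
    {n m : ℤ} (hS : (n, m) ∈ (rayNE e n₀ h₀ h).S) (hne : (n, m) ≠ (n₀, 3 * n₀ + e))
    (he : 2 * n + e - 1 ≠ 0) :
    (rayNE e n₀ h₀ h).A (n - 1) (m - 3) * (rayNE e n₀ h₀ h).D n m ≠ 0 := by
  obtain ⟨hn, hm⟩ := hS
  change n₀ ≤ n at hn
  change m = 3 * n + e at hm
  have hn' : n₀ + 1 ≤ n := by
    by_contra hlt
    have hnn : n = n₀ := le_antisymm (by omega) hn
    exact hne (Prod.ext hnn (by rw [hm, hnn]))
  change (if n₀ ≤ n - 1 ∧ m - 3 = 3 * (n - 1) + e then -(2 * ((n - 1 : ℤ) : ℂ) + e + 1) / 2 else 0) *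
      (if n₀ + 1 ≤ n ∧ m = 3 * n + e then (1 : ℂ) else 0) ≠ 0
  rw [if_pos ⟨by omega, by rw [hm]; ring⟩, if_pos ⟨hn', hm⟩, mul_one]
  have h2 : (2 * ((n - 1 : ℤ) : ℂ) + e + 1) ≠ 0 := by
    have : (2 * (n - 1) + e + 1 : ℤ) ≠ 0 := by omega
    exact_mod_cast this
  exact div_ne_zero (neg_ne_zero.2 h2) two_ne_zero

/-- On a south-east ray datum every `K`-type above the bottom one is reached from the `K`-type below it
by a live `B`–`C` edge. [cite: Kovacevic2021, §3 Thm 3 (b80), §4] -/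
private theorem raySE_lower (e n₀ : ℤ) (h₀ : 1 ≤ n₀) (h : 2 * n₀ ^ 2 + (e - 3) * n₀ + (1 - e) = 0)
    {n m : ℤ} (hS : (n, m) ∈ (raySE e n₀ h₀ h).S) (hne : (n, m) ≠ (n₀, -(3 * n₀ + e)))
    (he : 2 * n + e - 1 ≠ 0) :
    (raySE e n₀ h₀ h).B (n - 1) (m + 3) * (raySE e n₀ h₀ h).C n m ≠ 0 := by
  obtain ⟨hn, hm⟩ := hS
  change n₀ ≤ n at hn
  change m = -(3 * n + e) at hm
  have hn' : n₀ + 1 ≤ n := by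
    by_contra hlt
    have hnn : n = n₀ := le_antisymm (by omega) hn
    exact hne (Prod.ext hnn (by rw [hm, hnn]))
  change (if n₀ ≤ n - 1 ∧ m + 3 = -(3 * (n - 1) + e) then -(2 * ((n - 1 : ℤ) : ℂ) + e + 1) / 2 else 0) *
      (if n₀ + 1 ≤ n ∧ m = -(3 * n + e) then (1 : ℂ) else 0) ≠ 0
  rw [if_pos ⟨by omega, by rw [hm]; ring⟩, if_pos ⟨hn', hm⟩, mul_one]
  have h2 : (2 * ((n - 1 : ℤ) : ℂ) + e + 1) ≠ 0 := by
    have : (2 * (n - 1) + e + 1 : ℤ) ≠ 0 := by omega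
    exact_mod_cast this
  exact div_ne_zero (neg_ne_zero.2 h2) two_ne_zero

/-- `U(0)`: no `K`-type other than the vertex `V_{1,0}`. [cite: Kovacevic2021, §4 (`U(0)`)] -/
theorem trivialMod_lower (n m : ℤ) (hS : (n, m) ∈ trivialMod.S) (hne : (n, m) ≠ (1, 0)) :
    trivialMod.A (n - 1) (m - 3) * trivialMod.D n m ≠ 0 ∨
      trivialMod.B (n - 1) (m + 3) * trivialMod.C n m ≠ 0 :=
  absurd (show (n, m) = (1, 0) from hS) hne

/-- `D₂ = U(0,6)` is generated downward from its vertex `V_{1,6}` along live `A`–`D` edges.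
[cite: Kovacevic2021, §4 (c50)] [cite: BorelWallach2000, VI 4.10 (3)] -/
theorem holDS_lower (n m : ℤ) (hS : (n, m) ∈ holDS.S) (hne : (n, m) ≠ (1, 6)) :
    holDS.A (n - 1) (m - 3) * holDS.D n m ≠ 0 ∨ holDS.B (n - 1) (m + 3) * holDS.C n m ≠ 0 := by
  have hn := holDS.one_le_of_mem hS
  exact Or.inl (rayNE_lower 3 1 le_rfl (by norm_num) hS (fun h => hne (h.trans (by norm_num))) (by omega))

/-- `D₀ = U(0,-6)` is generated downward from its vertex `V_{1,-6}` along live `B`–`C` edges.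
[cite: Kovacevic2021, §4] [cite: BorelWallach2000, VI 4.10 (3)] -/
theorem antiholDS_lower (n m : ℤ) (hS : (n, m) ∈ antiholDS.S) (hne : (n, m) ≠ (1, -6)) :
    antiholDS.A (n - 1) (m - 3) * antiholDS.D n m ≠ 0 ∨
      antiholDS.B (n - 1) (m + 3) * antiholDS.C n m ≠ 0 := by
  have hn := antiholDS.one_le_of_mem hS
  exact Or.inr (raySE_lower 3 1 le_rfl (by norm_num) hS (fun h => hne (h.trans (by norm_num))) (by omega))

/-- `J_{1,0} = Z(3)` is generated downward from its vertex `V_{2,3}` along live `A`–`D` edges.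
[cite: Kovacevic2021, §4 (`Z(s)`)] [cite: BorelWallach2000, VI Thm 4.11 (9)] -/
theorem ladderPlus_lower (n m : ℤ) (hS : (n, m) ∈ ladderPlus.S) (hne : (n, m) ≠ (2, 3)) :
    ladderPlus.A (n - 1) (m - 3) * ladderPlus.D n m ≠ 0 ∨
      ladderPlus.B (n - 1) (m + 3) * ladderPlus.C n m ≠ 0 := by
  have h := (mem_ladderPlus n m).1 hS
  have hne' : ¬ (n = 2 ∧ m = 3) := fun h' => hne (Prod.ext h'.1 h'.2)
  exact Or.inl (rayNE_lower (-3) 2 (by norm_num) (by norm_num) hS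
    (fun h' => hne (h'.trans (by norm_num))) (by omega))

/-- `J_{0,1} = Z(-3)` is generated downward from its vertex `V_{2,-3}` along live `B`–`C` edges.
[cite: Kovacevic2021, §4 (`Z(s)`)] [cite: BorelWallach2000, VI Thm 4.11 (9)] -/
theorem ladderMinus_lower (n m : ℤ) (hS : (n, m) ∈ ladderMinus.S) (hne : (n, m) ≠ (2, -3)) :
    ladderMinus.A (n - 1) (m - 3) * ladderMinus.D n m ≠ 0 ∨
      ladderMinus.B (n - 1) (m + 3) * ladderMinus.C n m ≠ 0 := by
  have h := (mem_ladderMinus n m).1 hS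
  have hne' : ¬ (n = 2 ∧ m = -3) := fun h' => hne (Prod.ext h'.1 h'.2)
  exact Or.inr (raySE_lower (-3) 2 (by norm_num) (by norm_num) hS
    (fun h' => hne (h'.trans (by norm_num))) (by omega))

/-- `D₁ = W(3,0)` is generated downward from its vertex `V_{3,0}`: the cone point `(p,q) ≠ (0,0)` is
reached from `(p-1,q)` by a live `A`–`D` edge (`p ≥ 1`) or from `(p,q-1)` by a live `B`–`C` edge (`q ≥ 1`).
[cite: Kovacevic2021, §3 Thm 3 (b85), (b100), §4 (`W(r,s)`)] -/
theorem midDS_lower (n m : ℤ) (hS : (n, m) ∈ midDS.S) (hne : (n, m) ≠ (3, 0)) :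
    midDS.A (n - 1) (m - 3) * midDS.D n m ≠ 0 ∨ midDS.B (n - 1) (m + 3) * midDS.C n m ≠ 0 := by
  obtain ⟨p, q, hn, hm⟩ := hS
  change n = 3 + p + q at hn
  change m = 3 * p - 3 * q at hm
  have h0 : (n : ℂ) ≠ 0 := by exact_mod_cast (show n ≠ 0 by omega)
  have h1 : (n : ℂ) - 1 ≠ 0 := by
    have : (n - 1 : ℤ) ≠ 0 := by omega
    exact_mod_cast this
  rcases Nat.eq_zero_or_pos p with rfl | hp
  · -- `p = 0`: then `q ≥ 1`, use the `B`–`C` edge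
    have hq : q ≠ 0 := by
      rintro rfl
      exact hne (by rw [Prod.mk.injEq]; constructor <;> omega)
    obtain ⟨q', rfl⟩ := Nat.exists_eq_add_one_of_ne_zero hq
    right
    change midB (n - 1) (m + 3) * midC n m ≠ 0
    rw [midB_eq 0 q' (n := n - 1) (m := m + 3) (by omega) (by omega), midC_eq 0 (q' + 1) hn hm]
    refine mul_ne_zero (neg_ne_zero.2 ?_) (div_ne_zero ?_ (mul_ne_zero h1 h0))
    · exact_mod_cast (show ((q' + 2) * (q' + 3) : ℕ) ≠ 0 by positivity)
    · exact_mod_cast (show (q' + 1 : ℕ) ≠ 0 by omega)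
  · -- `p ≥ 1`: use the `A`–`D` edge
    obtain ⟨p', rfl⟩ := Nat.exists_eq_add_one_of_ne_zero (by omega : p ≠ 0)
    left
    change midA (n - 1) (m - 3) * midD n m ≠ 0
    rw [midA_eq p' q (n := n - 1) (m := m - 3) (by omega) (by omega), midD_eq (p' + 1) q hn hm]
    refine mul_ne_zero (neg_ne_zero.2 ?_) (div_ne_zero ?_ (mul_ne_zero h1 h0))
    · exact_mod_cast (show ((p' + 2) * (p' + 3) : ℕ) ≠ 0 by positivity)
    · exact_mod_cast (show (p' + 1 : ℕ) ≠ 0 by omega)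

end Models

variable (𝒟 : SU21Datum)

/-! ## §2 The vertex of a strongly connected cohomological datum -/

/-- **The vertex.** A strongly connected datum with Casimir scalar `0` on `S` and an `F`-label among its
`K`-types has a local minimum `x₀ ∈ {(1,0), (1,6), (1,-6), (2,3), (2,-3), (3,0)}` (by the vertex
equation for `n₀ ≥ 2`; for `n₀ = 1` the `F`-label lies in the cone above `x₀ = (1,m₀)` and in the
lattice `(1+p+q, 3p-3q)`, so `m₀ ∈ {0, ±6}`). [cite: BorelWallach2000, VI 4.10 (3), Thm 4.11 (1), (9)] -/
theorem vertex_mem_six (hconn : ∀ x ∈ 𝒟.S, ∀ y ∈ 𝒟.S, 𝒟.Reach x y)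
    (hcas : ∀ n m : ℤ, (n, m) ∈ 𝒟.S → 𝒟.casimirScalar n m = 0)
    (hF : ((1 : ℤ), (0 : ℤ)) ∈ 𝒟.S ∨ ((2 : ℤ), (3 : ℤ)) ∈ 𝒟.S ∨ ((2 : ℤ), (-3 : ℤ)) ∈ 𝒟.S ∨
      ((1 : ℤ), (6 : ℤ)) ∈ 𝒟.S ∨ ((1 : ℤ), (-6 : ℤ)) ∈ 𝒟.S ∨ ((3 : ℤ), (0 : ℤ)) ∈ 𝒟.S) :
    ∃ x₀ ∈ 𝒟.S, (x₀.1 - 1, x₀.2 - 3) ∉ 𝒟.S ∧ (x₀.1 - 1, x₀.2 + 3) ∉ 𝒟.S ∧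
      (x₀ = (1, 0) ∨ x₀ = (1, 6) ∨ x₀ = (1, -6) ∨ x₀ = (2, 3) ∨ x₀ = (2, -3) ∨ x₀ = (3, 0)) := by
  -- an `F`-label `f ∈ S`; it lies in the lattice `(1+p+q, 3p-3q)`
  obtain ⟨f, hfS, hfL, hf⟩ : ∃ f ∈ 𝒟.S, (∃ p q : ℤ, f = (1 + p + q, 3 * p - 3 * q)) ∧
      (f = (1, 0) ∨ f = (2, 3) ∨ f = (2, -3) ∨ f = (1, 6) ∨ f = (1, -6) ∨ f = (3, 0)) := by
    rcases hF with h | h | h | h | h | h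
    · exact ⟨_, h, ⟨0, 0, by norm_num⟩, Or.inl rfl⟩
    · exact ⟨_, h, ⟨1, 0, by norm_num⟩, Or.inr (Or.inl rfl)⟩
    · exact ⟨_, h, ⟨0, 1, by norm_num⟩, Or.inr (Or.inr (Or.inl rfl))⟩
    · exact ⟨_, h, ⟨1, -1, by norm_num⟩, Or.inr (Or.inr (Or.inr (Or.inl rfl)))⟩
    · exact ⟨_, h, ⟨-1, 1, by norm_num⟩, Or.inr (Or.inr (Or.inr (Or.inr (Or.inl rfl))))⟩
    · exact ⟨_, h, ⟨1, 1, by norm_num⟩, Or.inr (Or.inr (Or.inr (Or.inr (Or.inr rfl))))⟩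
  obtain ⟨x₀, h₀, h₀D, h₀C, -⟩ := exists_isLocalMin ⟨f, hfS⟩
  refine ⟨x₀, h₀, h₀D, h₀C, ?_⟩
  obtain ⟨a, b⟩ := x₀
  have hcone := cone_of_isLocalMin h₀D h₀C (hconn _ h₀ f hfS)
  obtain ⟨p, q, hpq⟩ := reach_lattice (hconn f hfS _ h₀) hfL
  simp only [Prod.mk.injEq] at hpq ⊢
  obtain ⟨hpa, hpb⟩ := hpq
  rcases vertex_eq h₀ h₀D h₀C (hcas a b h₀) with h1 | ⟨h2, h3 | h3⟩ | ⟨h3, h4⟩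
  · -- level `1`: the `F`-label lies in the cone above `(1, 6p)`
    rcases hf with hf | hf | hf | hf | hf | hf <;> (subst hf; dsimp only at hcone; omega)
  · exact Or.inr (Or.inr (Or.inr (Or.inl ⟨h2, h3⟩)))
  · exact Or.inr (Or.inr (Or.inr (Or.inr (Or.inl ⟨h2, h3⟩))))
  · exact Or.inr (Or.inr (Or.inr (Or.inr (Or.inr ⟨h3, h4⟩))))

/-! ## §3 The combinatorial classification -/

/-- **Classification of the strongly connected cohomological data.** If the live arrows of `𝒟` connect any
two `K`-types, the Casimir scalar vanishes on `S`, and one of `V_{1,0}, V_{2,±3}, V_{1,±6}, V_{3,0}` is a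
`K`-type, then `𝒟` has the `K`-types AND the gauge-invariant products `A D'`, `B C'` of one of the six
models `U(0)`, `U(0,±6)`, `Z(±3)`, `W(3,0)`. [cite: BorelWallach2000, VI 4.8, Thm 4.11 (1)]
[cite: Kovacevic2021, §3 Thm 2, Remark 3, §4 Thm 5] -/
theorem exists_model_of_forall_reach (hconn : ∀ x ∈ 𝒟.S, ∀ y ∈ 𝒟.S, 𝒟.Reach x y)
    (hcas : ∀ n m : ℤ, (n, m) ∈ 𝒟.S → 𝒟.casimirScalar n m = 0)
    (hF : ((1 : ℤ), (0 : ℤ)) ∈ 𝒟.S ∨ ((2 : ℤ), (3 : ℤ)) ∈ 𝒟.S ∨ ((2 : ℤ), (-3 : ℤ)) ∈ 𝒟.S ∨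
      ((1 : ℤ), (6 : ℤ)) ∈ 𝒟.S ∨ ((1 : ℤ), (-6 : ℤ)) ∈ 𝒟.S ∨ ((3 : ℤ), (0 : ℤ)) ∈ 𝒟.S) :
    ∃ T : SU21Datum, (T = trivialMod ∨ T = holDS ∨ T = antiholDS ∨ T = ladderPlus ∨
        T = ladderMinus ∨ T = midDS) ∧ 𝒟.S = T.S ∧
      (∀ n m : ℤ, 𝒟.A n m * 𝒟.D (n + 1) (m + 3) = T.A n m * T.D (n + 1) (m + 3)) ∧
      (∀ n m : ℤ, 𝒟.B n m * 𝒟.C (n + 1) (m - 3) = T.B n m * T.C (n + 1) (m - 3)) := by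
  obtain ⟨x₀, h₀, h₀D, h₀C, hx₀⟩ := 𝒟.vertex_mem_six hconn hcas hF
  have hdown : ∀ n m : ℤ, (n, m) ∈ 𝒟.S → (n, m) ≠ x₀ →
      𝒟.A (n - 1) (m - 3) * 𝒟.D n m ≠ 0 ∨ 𝒟.B (n - 1) (m + 3) * 𝒟.C n m ≠ 0 :=
    fun n m hS hne => exists_lower_of_ne hconn h₀ h₀D h₀C hS hne
  have hcas1 : ∀ m : ℤ, ((1 : ℤ), m) ∈ 𝒟.S → 𝒟.casimirScalar 1 m = 0 := fun m h => hcas 1 m h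
  -- unique continuation from the vertex, against a model `T` with the same vertex
  have conclude : ∀ T : SU21Datum, x₀ ∈ T.S →
      (∀ n m : ℤ, (n, m) ∈ T.S → (n, m) ≠ x₀ →
        T.A (n - 1) (m - 3) * T.D n m ≠ 0 ∨ T.B (n - 1) (m + 3) * T.C n m ≠ 0) →
      T.casimir = 0 →
      𝒟.S = T.S ∧ (∀ n m : ℤ, 𝒟.A n m * 𝒟.D (n + 1) (m + 3) = T.A n m * T.D (n + 1) (m + 3)) ∧
        (∀ n m : ℤ, 𝒟.B n m * 𝒟.C (n + 1) (m - 3) = T.B n m * T.C (n + 1) (m - 3)) := by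
    intro T hT hTdown hTcas
    have key := mem_iff_and_products_eq_of_vertex h₀ hT hdown hTdown hcas1
      (fun m h => casimirScalar_eq_zero_of_casimir_eq_zero hTcas h)
    exact ⟨Set.ext fun x => (key x.1 x.2).1, fun n m => (key n m).2.1, fun n m => (key n m).2.2⟩
  rcases hx₀ with rfl | rfl | rfl | rfl | rfl | rfl
  · exact ⟨trivialMod, Or.inl rfl, conclude trivialMod rfl trivialMod_lower casimir_trivialMod⟩
  · exact ⟨holDS, Or.inr (Or.inl rfl),
      conclude holDS ((mem_holDS 1 6).2 ⟨le_rfl, by norm_num⟩) holDS_lower casimir_holDS⟩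
  · exact ⟨antiholDS, Or.inr (Or.inr (Or.inl rfl)),
      conclude antiholDS ((mem_antiholDS 1 (-6)).2 ⟨le_rfl, by norm_num⟩) antiholDS_lower casimir_antiholDS⟩
  · exact ⟨ladderPlus, Or.inr (Or.inr (Or.inr (Or.inl rfl))),
      conclude ladderPlus ((mem_ladderPlus 2 3).2 ⟨le_rfl, by norm_num⟩) ladderPlus_lower casimir_ladderPlus⟩
  · exact ⟨ladderMinus, Or.inr (Or.inr (Or.inr (Or.inr (Or.inl rfl)))),
      conclude ladderMinus ((mem_ladderMinus 2 (-3)).2 ⟨le_rfl, by norm_num⟩) ladderMinus_lower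
        casimir_ladderMinus⟩
  · exact ⟨midDS, Or.inr (Or.inr (Or.inr (Or.inr (Or.inr rfl)))),
      conclude midDS ((mem_midDS 3 0).2 ⟨0, 0, by norm_num, by norm_num⟩) midDS_lower casimir_midDS⟩

/-- **The `K`-types of a strongly connected cohomological datum** are those of `U(0)`, `U(0,6)`, `U(0,-6)`,
`Z(3)`, `Z(-3)` or `W(3,0)` (`= J_{0,0}, D₂, D₀, J_{1,0}, J_{0,1}, D₁`).
[cite: BorelWallach2000, VI 4.8, Thm 4.11 (1)] [cite: Kovacevic2021, §4 Thm 5] -/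
theorem S_eq_six_of_forall_reach (hconn : ∀ x ∈ 𝒟.S, ∀ y ∈ 𝒟.S, 𝒟.Reach x y)
    (hcas : ∀ n m : ℤ, (n, m) ∈ 𝒟.S → 𝒟.casimirScalar n m = 0)
    (hF : ((1 : ℤ), (0 : ℤ)) ∈ 𝒟.S ∨ ((2 : ℤ), (3 : ℤ)) ∈ 𝒟.S ∨ ((2 : ℤ), (-3 : ℤ)) ∈ 𝒟.S ∨
      ((1 : ℤ), (6 : ℤ)) ∈ 𝒟.S ∨ ((1 : ℤ), (-6 : ℤ)) ∈ 𝒟.S ∨ ((3 : ℤ), (0 : ℤ)) ∈ 𝒟.S) :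
    𝒟.S = trivialMod.S ∨ 𝒟.S = holDS.S ∨ 𝒟.S = antiholDS.S ∨ 𝒟.S = ladderPlus.S ∨
      𝒟.S = ladderMinus.S ∨ 𝒟.S = midDS.S := by
  obtain ⟨T, hT, hS, -, -⟩ := 𝒟.exists_model_of_forall_reach hconn hcas hF
  rw [hS]
  rcases hT with rfl | rfl | rfl | rfl | rfl | rfl
  · exact Or.inl rfl
  · exact Or.inr (Or.inl rfl)
  · exact Or.inr (Or.inr (Or.inl rfl))
  · exact Or.inr (Or.inr (Or.inr (Or.inl rfl)))
  · exact Or.inr (Or.inr (Or.inr (Or.inr (Or.inl rfl))))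
  · exact Or.inr (Or.inr (Or.inr (Or.inr (Or.inr rfl))))

/-! ## §4 Irreducible cohomological data (Borel–Wallach VI Thm 4.11 (1)) -/

variable {𝒟} in
/-- **An irreducible datum is strongly connected**: any `K`-type is reached from any other along live
arrows (the `K`-types reachable from `x` form an arrow-closed set meeting `S`).
[cite: Kovacevic2021, §3 proof of Thm 2, Remark 2, Remark 6] -/
theorem forall_reach_of_isIrreducible [hirr : LieModule.IsIrreducible ℂ gl3 𝒟.V] :
    ∀ x ∈ 𝒟.S, ∀ y ∈ 𝒟.S, 𝒟.Reach x y := by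
  intro x hx y hy
  have hclosed := (isIrreducible_iff_closed.1 hirr).2
  refine hclosed {z | 𝒟.Reach x z} ?_ ?_ ?_ ?_ ⟨x, Relation.ReflTransGen.refl, hx⟩ hy
  · intro n m hR hA hS'
    exact Relation.ReflTransGen.tail hR ⟨Dir.A, mem_of_coef_ne_zero Dir.A hA, hS', rfl, hA⟩
  · intro n m hR hB hS'
    exact Relation.ReflTransGen.tail hR ⟨Dir.B, mem_of_coef_ne_zero Dir.B hB, hS', rfl, hB⟩
  · intro n m hR hC hS'
    exact Relation.ReflTransGen.tail hR ⟨Dir.C, mem_of_coef_ne_zero Dir.C hC, hS', rfl, hC⟩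
  · intro n m hR hD hS'
    exact Relation.ReflTransGen.tail hR ⟨Dir.D, mem_of_coef_ne_zero Dir.D hD, hS', rfl, hD⟩

/-- **Borel–Wallach VI Thm 4.11 (1) for `SU(2,1)`, datum form, with the products.** An irreducible
`K`-type datum with `dim H^q(𝔤𝔩₃, 𝔨; V) ≠ 0` for some `q` has the `K`-types and the gauge-invariant
products `A D'`, `B C'` of one of `U(0) = J_{0,0}`, `U(0,6) = D₂`, `U(0,-6) = D₀`, `Z(3) = J_{1,0}`,
`Z(-3) = J_{0,1}`, `W(3,0) = D₁` — i.e. `V ∈ Π^ρ(SU(2,1))` up to the gauge of [Kovacevic2021, Remark 3].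
[cite: BorelWallach2000, VI 4.8 p. 131, Thm 4.11 (1) p. 132] [cite: Kovacevic2021, §3 Thm 2, §4 Thm 5] -/
theorem exists_model_of_isIrreducible [LieModule.IsIrreducible ℂ gl3 𝒟.V] {q : ℕ}
    (hq : finrank ℂ (relCohomology ℂ gl3 𝒟.V kSub q) ≠ 0) :
    ∃ T : SU21Datum, (T = trivialMod ∨ T = holDS ∨ T = antiholDS ∨ T = ladderPlus ∨
        T = ladderMinus ∨ T = midDS) ∧ 𝒟.S = T.S ∧
      (∀ n m : ℤ, 𝒟.A n m * 𝒟.D (n + 1) (m + 3) = T.A n m * T.D (n + 1) (m + 3)) ∧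
      (∀ n m : ℤ, 𝒟.B n m * 𝒟.C (n + 1) (m - 3) = T.B n m * T.C (n + 1) (m - 3)) :=
  let ⟨hcas, hF⟩ := 𝒟.cohomological_input hq
  𝒟.exists_model_of_forall_reach forall_reach_of_isIrreducible hcas hF

/-- **Borel–Wallach VI Thm 4.11 (1) for `SU(2,1)`, datum form.** If `𝒟.V` is irreducible and
`dim H^q(𝔤𝔩₃, 𝔨; V) ≠ 0` for some `q`, then the `K`-types of `V` are those of `J_{0,0} = U(0)`,
`D₂ = U(0,6)`, `D₀ = U(0,-6)`, `J_{1,0} = Z(3)`, `J_{0,1} = Z(-3)` or `D₁ = W(3,0)`.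
[cite: BorelWallach2000, VI 4.8 p. 131, Thm 4.11 (1) p. 132] -/
theorem S_eq_six_of_isIrreducible [LieModule.IsIrreducible ℂ gl3 𝒟.V] {q : ℕ}
    (hq : finrank ℂ (relCohomology ℂ gl3 𝒟.V kSub q) ≠ 0) :
    𝒟.S = trivialMod.S ∨ 𝒟.S = holDS.S ∨ 𝒟.S = antiholDS.S ∨ 𝒟.S = ladderPlus.S ∨
      𝒟.S = ladderMinus.S ∨ 𝒟.S = midDS.S :=
  let ⟨hcas, hF⟩ := 𝒟.cohomological_input hq
  𝒟.S_eq_six_of_forall_reach forall_reach_of_isIrreducible hcas hF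

end SU21Datum

end Literature.RepresentationTheory.Kovacevic2021
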